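import Mathlib.Tactic.Linarith
import Mathlib.Tactic.Ring
import Mathlib.Tactic.NormNum
import Mathlib.Tactic.IntervalCases
import Mathlib.Tactic.Abel
import Mathlib.Data.Nat.Choose.Basic
import Mathlib.Algebra.Group.Even
import Mathlib.Data.Set.Basic
import HarnessLib
import Summits.HodgeConjecture.HodgeConjecture.Theorems.WeilTypeLadderH2UniformPlaneII

/-!
# The (0,1) cell of the ι-window, EXISTENCE side, XXII: arithmetic skeleton of `H2-EXISTENCE-SIDE-22.md` (prover 3 gen 29)

Family `hodge`, b2b cell `hweil`, `Summits/HodgeConjecture/HodgeConjecture/Theorems` (helper of item stmt-HodgeConjecture-2524). New topic, new file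
(the lineage's `WeilTypeLadderH2UniformPlaneII.lean` is at 374/400 lines; it is IMPORTED here for one corollary of its `two_theta_ci_enumeration`).

Setting and notation as in the report and in [XVI]–[XXI]: `(A, Θ)` a general ppav fourfold (`NS = ℤθ`, `Θ` smooth), `γ = θ³/6`, `κ` the Kummer map
into `|2Θ| = ℙ¹⁵`, `ℙ(Λ_a) = 𝕋_{κ(a)}Kum(A)`, `S_a = Θ_a ∩ Θ_{−a}`, the secant lines `ℓ_{a,c}`, the bitangent locus `M`. NEW in [XXII]: a general ppav
fourfold is a Prym variety `P(C̃/C)` (`g_C = 5`, étale; Donagi 1992 Thm 5.1), and for such a presentation Beauville–Debarre (Ann. Sc. Norm. Sup. Pisa 14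
(1987), Prop. 1.1–1.2 = Debarre's thèse IV.B) proved `Θ ∩ Θ_{[p,q]} ∩ Θ_{[p,r]} = W_p ∪ S_{pqr} ⊂ Θ_{[p,s]} ∪ Θ_{[q,r]}` (`[x] := x − σx`, `[p,q] := [p] + [q]`;
classes `2γ` and `4γ`) and hence that `Kum(A)` has a 4-parameter family of QUADRISECANT PLANES: for `a = [p,q]`, `b = [p,r]`, `x = [p,s]`, `y = [q,r]`,
`2ζ = x + y`, the points `κ(ζ), κ(ζ−a), κ(ζ−b), κ(ζ−x)` are coplanar. The report reads this in the cell's language (THEOREM Q: explicit Sec∩Sec /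
Tan∩Sec / Tan∩Tan members; `M ⊇ ⋃ Z × Z`; LEMMA TD: the theta-dual `T_Z` of an ι-invariant Abel–Prym curve lies in `S_a` for every `a ∈ Z`) and
transfers the secant-habitat strata (THEOREM F_sec, LEMMA SB, COR G_sec, THEOREM K_sec, PROP SA). HONEST FRAMING: this file records ARITHMETIC /
BOOKKEEPING shadows of pen-and-paper statements whose geometric content (Pryms, theta divisors, Kummer varieties, sheaves) is NOT kernel-checked;
census results about one cell of the ladder's H2 test on the existence side; no case of the Hodge conjecture is proved; nothing here is a rung; no
statement of [Markman 2025] is used. 0 unconditional rungs above the floor.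
-/

set_option linter.dupNamespace false

namespace Summit.HodgeConjecture.HodgeConjecture.WeilTypeLadder

section H2QuadrisecantXXII

/-- THEOREM Q, setting 3.0 (report §3): the four half-points of a Beauville–Debarre quadrisecant plane. In the (free) additive group on the
Abel–Prym classes `P = [p], Q = [q], R = [r], S = [s]` (with `[σx] = −[x]`), put `a = P + Q`, `b = P + R`, `x = P + S`, `y = Q + R`, `s̄ = x + y`
(`= 2ζ`). Then `s̄ − 2a = R + S − P − Q`, `s̄ − 2b = Q + S − P − R`, `s̄ − 2x = Q + R − P − S` (the three pair-partitions of `{p,q,r,s}`), and the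
twelve sums/differences of the `u_i` (`u₀ = ζ`, `u₁ = ζ − a`, `u₂ = ζ − b`, `u₃ = ζ − x`), written without halving as `s̄ − a − a′` resp.
`a′ − a`: `u₀+u₃ ↦ s̄ − x = y`, `u₀+u₁ ↦ s̄ − a = R + S` (`= [r,s]`), `u₀+u₂ ↦ s̄ − b = Q + S`, `u₁+u₂ ↦ s̄ − a − b = S − P`, `u₁−u₂ ↦ b − a = R − Q`,
`u₁+u₃ ↦ s̄ − a − x = R − P`, `u₂+u₃ ↦ s̄ − b − x = Q − P`, `u₂−u₃ ↦ x − b = S − R`, `u₁−u₃ ↦ x − a = S − Q`. MERGES: at `(q, s) = (p, σr)`, i.e.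
`Q = P`, `S = −R`, one has `s̄ = P + P` (so `ζ = [p] + η`), `s̄ − a = 0` (`κ(u₀) = κ(u₁)`) and `s̄ − b − x = 0` (`κ(u₂) = κ(u₃)`), while `b − a = R − P`
and `x − b = −(R + R)` stay non-zero — the Tan∩Tan limit of 3.3; at `s = σr` alone (`S = −R`): `s̄ − a = 0` only — the Tan∩Sec limit of 3.2.
Recorded: the identities, in any additive commutative group. -/
theorem quadrisecant_pairings {G : Type*} [AddCommGroup G] (P Q R S : G) :
    let a := P + Q; let b := P + R; let x := P + S; let y := Q + R; let sbar := x + y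
    (sbar = P + Q + R + S) ∧ (sbar - a - a = R + S - P - Q) ∧ (sbar - b - b = Q + S - P - R) ∧ (sbar - x - x = Q + R - P - S) ∧
    (sbar - x = y) ∧ (sbar - a = R + S) ∧ (sbar - b = Q + S) ∧ (sbar - a - b = S - P) ∧ (b - a = R - Q) ∧
    (sbar - a - x = R - P) ∧ (sbar - b - x = Q - P) ∧ (x - b = S - R) ∧ (x - a = S - Q) ∧
    (Q = P → S = -R → sbar = P + P ∧ sbar - a = 0 ∧ sbar - b - x = 0 ∧ b - a = R - P ∧ x - b = -(R + R)) ∧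
    (S = -R → sbar - a = 0) := by
  dsimp only
  refine ⟨by abel, by abel, by abel, by abel, by abel, by abel, by abel, by abel, by abel, by abel, by abel, by abel, by abel, ?_, ?_⟩
  · intro hQ hS
    subst hQ; subst hS
    refine ⟨by abel, by abel, by abel, by abel, by abel⟩
  · intro hS
    subst hS
    abel

/-- LEMMA TD (a) (report 2.5), the one step that is pure group theory: for a SYMMETRIC subset `Θ` of an additive group (`Θ = −Θ`) and points
`a, t`, `a − t ∈ Θ ↔ t − a ∈ Θ`. With `Θ_t := Θ + t`: `a ∈ Θ_t ↔ a − t ∈ Θ ↔ t − a ∈ Θ ↔ t ∈ Θ_a`; so if a curve `Z` lies in `Θ_t` then `t ∈ Θ_a` for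
every `a ∈ Z`, and if `Z = −Z` also `t ∈ Θ_{−a}`: the theta-dual `T_Z = {t : Z ⊂ Θ_t}` lies in `S_a = Θ_a ∩ Θ_{−a}` for EVERY `a ∈ Z` — every pair of
points of an ι-invariant Abel–Prym curve is a curve-sharing pair (the dual curve `T_Z` has pure dimension 1 and class `2γ` by
Casalaina-Martin–Lahoz–Viviani 2008 Thm 2.2 / De Concini–Pragacz). Recorded: the symmetry step. -/
theorem theta_dual_symmetry {G : Type*} [AddCommGroup G] (Θ : Set G) (hΘ : ∀ z, z ∈ Θ ↔ -z ∈ Θ) (a t : G) :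
    (a - t ∈ Θ ↔ t - a ∈ Θ) ∧ (a - t ∈ Θ → (-a) - (-t) ∈ Θ) := by
  constructor
  · rw [hΘ (a - t), neg_sub]
  · intro h
    have : (-a) - (-t) = -(a - t) := by abel
    rw [this, ← hΘ]
    exact h

/-- PROPOSITION BD1 re-derivation (report 2.3), the arithmetic of Mumford's parity trick and of Riemann–Roch on `C̃` (genus `9`): a divisor
class in `P⁺` has EVEN `h⁰`, so 'effective' (`h⁰ ≥ 1`) forces `h⁰ ≥ 2`; one in `P⁻` has ODD `h⁰`, so `h⁰ ≥ 2` forces `h⁰ ≥ 3` (this is `W_p = V² + [p]`: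
`h⁰(L(−p)) ≥ 2 ⟺ h⁰(L ⊗ 𝒪(σp − p)) ≥ 3`); Riemann–Roch: `χ(L) = 8 + 1 − 9 = 0` for `deg L = 8` (so `h⁰(L) = h⁰(ω ⊗ L⁻¹) = h⁰(σ^*L)`), and
`h⁰(L(σp + σq)) = 10 + 1 − 9 + h⁰(L(−p−q)) = 2 + h⁰(L(−p−q))`. Recorded: the four arithmetic facts. -/
theorem bd_parity_step :
    (∀ n : ℕ, Even n → 1 ≤ n → 2 ≤ n) ∧ (∀ n : ℕ, Odd n → 2 ≤ n → 3 ≤ n) ∧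
    ((8 : ℤ) + 1 - 9 = 0) ∧ (∀ h : ℤ, (10 : ℤ) + 1 - 9 + h = 2 + h) := by
  refine ⟨?_, ?_, by norm_num, fun h => by ring⟩
  · rintro n ⟨k, rfl⟩ h1
    omega
  · rintro n ⟨k, rfl⟩ h2
    omega

/-- PROPOSITION BD1 (report 2.3 (5)) and THEOREM Q (a) (3) (report 3.1), the class bookkeeping: the complete-intersection curve
`Θ ∩ Θ_{[p,q]} ∩ Θ_{[p,r]}` has class `θ³ = 6γ` and splits as `S_{pqr}` (class `4θ³/3! = 4γ`, Beauville 1982 via [BD87]) plus `W_p` (class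
`θ³ − 4θ³/3! = 2θ³/3! = 2γ` = the class of `V²`, De Concini–Pragacz), each with multiplicity ONE (`6 = 4 + 2·1` leaves no room); their
`θ`-degrees (`θ·γ = 4`) are `16` and `8`, summing to `θ·θ³ = 24`. Recorded: the arithmetic, in units of `γ`. -/
theorem bd_cycle_classes :
    ((4 : ℤ) + 2 = 6) ∧ ((6 : ℤ) - 4 = 2) ∧ (∀ m : ℕ, 4 + 2 * m = 6 → m = 1) ∧ ((4 : ℤ) * 4 = 16) ∧ ((4 : ℤ) * 2 = 8) ∧ ((16 : ℤ) + 8 = 24) ∧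
    ((6 : ℚ) * (4 / 6) = 4) ∧ ((6 : ℚ) * (2 / 6) = 2) := by
  refine ⟨by norm_num, by norm_num, fun m hm => by omega, by norm_num, by norm_num, by norm_num, by norm_num, by norm_num⟩

/-- THEOREM Q (a) (4) (report 3.1), the shared-curve WEIGHTS are forced: the plane `Σ₂ = Θ_a ∩ Θ_b` of the second pencil meets the partner planes
`Σ₁ = Θ ∩ Θ_x`, `Σ₁′ = Θ ∩ Θ_y` of the first along the BD curves `W_p ⊂ Θ_x` (θ-degree `8`, generic multiplicity `u ≥ 1`) and `S_{pqr} ⊂ Θ_y`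
(θ-degree `16`, multiplicity `u′ ≥ 1`), possibly also along `S_{pqr}` if `S_{pqr} ⊂ Θ_x` (`e′ = 1`) resp. `W_p` if `W_p ⊂ Θ_y` (`e = 1`); on a theta
section `c(Σ₂, Σ₁) + c(Σ₂, Σ₁′) = σ₂·h = 24` ([XXI] 2.4). The only solution: `u = u′ = 1`, `e = e′ = 0` — weights `(c(σ₂,σ₁), c(σ₂,Θ−σ₁)) = (8, 16)`.
Recorded: the Diophantine fact. -/
theorem shared_weights_forced (u u' e e' : ℕ) (hu : 1 ≤ u) (hu' : 1 ≤ u') (he : e ≤ 1) (he' : e' ≤ 1)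
    (h : 8 * u + 16 * u' + 8 * u * e + 16 * u' * e' = 24) : u = 1 ∧ u' = 1 ∧ e = 0 ∧ e' = 0 := by
  interval_cases e <;> interval_cases e' <;> simp only [Nat.mul_zero, Nat.mul_one, Nat.add_zero] at h <;> omega

/-- THEOREM Q (a) REMARK (ii) (report 3.1): on the Beauville–Debarre members the two theta classes `σ₁, σ₂` share curves of KNOWN weights
`c ∈ {8, 16}`, so [XXI] THEOREM M (c)'s Diophantine census applies WITHOUT the clause (odd): `n₁n₂c = 6(n₁+n₂)² − 14 + 4v₃(T)` with
`v₃(T) ∈ {0, 2, 3}` has NO solution with `n₁n₂ ≠ 0` for `c = 8` or `c = 16` — a corollary of the lineage's `two_theta_ci_enumeration`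
(imported from `WeilTypeLadderH2UniformPlaneII`), whose only solutions have `c ∈ {4, 20}`. Every two-class hull on a BD member is H2-sterile,
unconditionally. -/
theorem bd_two_class_sterile (n n' c v : ℤ) (hc : c = 8 ∨ c = 16) (hv : v = 0 ∨ v = 2 ∨ v = 3) (hnn : n * n' ≠ 0)
    (h : n * n' * c = 6 * (n + n') ^ 2 - 14 + 4 * v) : False := by
  have hc' : c = 4 ∨ c = 8 ∨ c = 12 ∨ c = 16 ∨ c = 20 := by
    rcases hc with h8 | h16
    · exact Or.inr (Or.inl h8)
    · exact Or.inr (Or.inr (Or.inr (Or.inl h16)))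
  rcases two_theta_ci_enumeration n n' c v hc' hv hnn h with ⟨h20, _⟩ | ⟨h4, _⟩
  · rcases hc with h8 | h16 <;> omega
  · rcases hc with h8 | h16 <;> omega

/-- THEOREM Q (a) (2) (report 3.1), independence of the two classes read on a theta section: the Gram matrix of `(h, σ₁, σ₂)` with `h² = 48`,
`h·σᵢ = 24`, `σᵢ² = 0`, `σ₁·σ₂ = c` has determinant `48·c·(24 − c)` ([XXI] 8.1 (a)); at the BD weights `c = 8, 16` it equals `6144 ≠ 0`, so `Θ, σ₁, σ₂`
are linearly independent in `Cl(E)/Pic⁰` whenever the theta section is available (finite singular locus). Recorded: the evaluation and the cofactor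
expansion as an identity in `c`. -/
theorem gram_det_bd_weights (c : ℤ) :
    (48 * (0 * 0 - c * c) - 24 * (24 * 0 - c * 24) + 24 * (24 * c - 0 * 24) = 48 * c * (24 - c)) ∧
    ((48 : ℤ) * 8 * (24 - 8) = 6144) ∧ ((48 : ℤ) * 16 * (24 - 16) = 6144) ∧ ((6144 : ℤ) ≠ 0) := by
  refine ⟨by ring, by norm_num, by norm_num, by norm_num⟩

/-- COROLLARY Q1 / §4.3 (report): family dimensions and EXPECTED dimensions (the latter a labelled heuristic, used for nothing). BD families per
presentation: Sec∩Sec `4` (`(p,q,r,s) ∈ C̃⁴`), Tan∩Sec `4 − 1 = 3` (`s = σr`), Tan∩Tan `4 − 2 = 2` (`s = σr`, `q = p`; `= dim Z × Z = 1 + 1`); over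
the `2`-dimensional family of presentations (Donagi: fibre of `ℛ₅ → 𝒜₄` over a general point is a surface, `12 − 10 = 2`) the bitangent family
has `≤ 2 + 2 = 4` parameters — [XVI] 7.2's numerical `dim M = 4`. Expected dimensions in `ℙ¹⁵` (incidence `{(line, point)}` of secant lines
`8 + 1 = 9`, of tangent 4-planes `4 + 4 = 8`): Sec∩Sec `9 + 9 − 15 = 3`, Tan∩Sec `8 + 9 − 15 = 2`, Tan∩Tan `8 + 8 − 15 = 1` (Porteous, [XVI] 4.4),
THREE secant lines `27 − 30 = −3`, a BD plane plus a third line `4 + 9 − 15 = −2`; 6-secant `ℙ³`'s of a fourfold in `ℙ¹⁵`: `dim Gr(3,15) = 4·12 = 48`,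
six incidences of codimension `15 − 3 − 4 = 8` each: `48 − 48 = 0`, and concurrency of three pair-lines in `ℙ³` costs `1 + 2 = 3` more; a complete
quadrangle has `C(4,2) = 6` sides and `6/2 = 3` pair-partitions (diagonal points), each on exactly `2` sides. Recorded: the arithmetic. -/
theorem bd_family_and_expected_dimensions :
    ((4 : ℤ) - 1 = 3 ∧ (4 : ℤ) - 2 = 2 ∧ (1 : ℤ) + 1 = 2 ∧ (12 : ℤ) - 10 = 2 ∧ (2 : ℤ) + 2 = 4) ∧
    ((8 : ℤ) + 1 = 9 ∧ (4 : ℤ) + 4 = 8 ∧ (9 : ℤ) + 9 - 15 = 3 ∧ (8 : ℤ) + 9 - 15 = 2 ∧ (8 : ℤ) + 8 - 15 = 1 ∧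
      (9 : ℤ) + 9 + 9 - 15 - 15 = -3 ∧ (4 : ℤ) + 9 - 15 = -2) ∧
    ((4 : ℤ) * 12 = 48 ∧ (15 : ℤ) - 3 - 4 = 8 ∧ (48 : ℤ) - 6 * 8 = 0 ∧ (1 : ℤ) + 2 = 3 ∧ (0 : ℤ) - 3 = -3) ∧
    (Nat.choose 4 2 = 6 ∧ 6 / 2 = 3) := by
  refine ⟨by norm_num, by norm_num, by norm_num, by decide⟩

/-- COR G_sec / PROP SA (report 5.3, 5.5): the KRULL counts of the secant strata. Open part and (S-b): the incidence `𝒞⁺_sec` is cut in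
`𝒫 × k^×` (dimension `8 + d″ + 1 = 9 + d″`, `d″ = dim` of the carrier stratum) by a section of a bundle of rank `≤ 5` (`res_Z H⁰(2Θ) = f^*H⁰(ω_C)`,
`g_C = 5`): components `≥ 9 + d − 5 = 4 + d`. (S-a)′ with ONE base-node orbit on `Z`: base `{(a,c,Z,y) : y ∈ Z ∩ S_a ∩ S_c}` of dimension `d + 1 + 4`
(`y ∈ S_a ⟺ a ∈ S_y`: the fibre is `S_y × S_y`), and both pencil generators vanish doubly at the orbit — the section lives in `f^*H⁰(ω_C(−2p̄))`, rank
`5 − 2 = 3`: components `≥ d + 5 + 1 − 3 = d + 3`. TWO orbits: the fibre `{a : y₁, y₂ ∈ S_a} = S_{y₁} ∩ S_{y₂} ⊇ T_Z` is a CURVE (LEMMA TD) but `a ∈ T_Z =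
V_Z` is scoping, so the allowed fibre is finite: base dimension `d + 2 + 0`, rank `5 − c₂` with `c₂ ∈ {3, 4}` (Riemann–Roch on `C`:
`h⁰(ω_C(−2p̄−2q̄)) = h⁰(2p̄+2q̄) ∈ {1, 2}`): components `≥ d + 2 + 1 − (5 − c₂) ≥ d + 1`. THREE orbits: `c₃ = 4` is forced (`c₃ = 5` would make a
generator vanish identically on `Z`, i.e. `a` or `c ∈ V_Z`), and the bound degenerates to `≥` the base's own dimension: no kill by counting. Recorded:
the arithmetic for all `d` and the admissible `c₂`. -/
theorem secant_node_krull (d c₂ : ℤ) (hc : c₂ = 3 ∨ c₂ = 4) :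
    (9 + d - 5 = 4 + d) ∧ (d + 1 + 4 + 1 - (5 - 2) = d + 3) ∧ (d + 1 ≤ d + 2 + 0 + 1 - (5 - c₂)) ∧
    (∀ b : ℤ, b + 1 - (5 - 4) = b) ∧ ((5 : ℤ) - 5 = 0) := by
  refine ⟨by ring, by ring, ?_, fun b => by ring, by norm_num⟩
  rcases hc with rfl | rfl <;> omega

/-- PROP SA (c) (report 5.5), the numbers of conditions `c_k` via Riemann–Roch on the genus-`5` base curve `C`: `h⁰(ω_C(−D)) = h⁰(D) − deg D − 1 + 5`;
for `D = 2p̄` (`h⁰ = 1`, `C` non-hyperelliptic): `1 − 2 − 1 + 5 = 3`, `c₁ = 5 − 3 = 2`; for `D = 2p̄ + 2q̄` (`h⁰ ∈ {1, 2}`, Clifford): `h⁰ − 4 − 1 + 5 = h⁰`,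
`c₂ = 5 − h⁰ ∈ {4, 3}`; for `D = 2(p̄+q̄+r̄)` (`h⁰ ∈ {2, 3}`): `h⁰ − 6 − 1 + 5 = h⁰ − 2 ∈ {0, 1}`, `c₃ ∈ {5, 4}`. Recorded: the arithmetic. -/
theorem canonical_conditions_genus5 :
    (∀ h0 degD : ℤ, h0 - degD - 1 + 5 = h0 + 4 - degD) ∧ ((1 : ℤ) - 2 - 1 + 5 = 3 ∧ (5 : ℤ) - 3 = 2) ∧
    (∀ h0 : ℤ, (h0 = 1 ∨ h0 = 2) → (h0 - 4 - 1 + 5 = h0 ∧ (5 - h0 = 4 ∨ 5 - h0 = 3))) ∧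
    (∀ h0 : ℤ, (h0 = 2 ∨ h0 = 3) → (h0 - 6 - 1 + 5 = h0 - 2 ∧ (5 - (h0 - 2) = 5 ∨ 5 - (h0 - 2) = 4))) := by
  refine ⟨fun h0 degD => by ring, by norm_num, ?_, ?_⟩
  · rintro h0 (rfl | rfl) <;> norm_num
  · rintro h0 (rfl | rfl) <;> norm_num

/-- §4.4 (report): the five surviving three-class patterns of [XXI] 8.2 (weights `(c₁₂, c₁₃, c₂₃)` with `|nᵢ| = 1`) all use weights in `{8, 16}` —
exactly the two weights the Beauville–Debarre configurations realise (`8` along a `2γ`-curve `W_p`/`T_Z`, `16` along a `4γ`-curve `S_{pqr}`); so the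
numerics of (d-θ-3) are compatible with BD-type sharing, and (d-θ-3) is re-posed as the geometric question Q-P3g29-1 (three CONCURRENT Kummer
secant lines). Recorded: the membership check. -/
theorem three_class_patterns_use_bd_weights :
    ∀ t ∈ [((8 : ℕ), (16 : ℕ), (16 : ℕ)), (16, 16, 16), (8, 8, 8), (16, 8, 16), (16, 8, 8)],
      (t.1 = 8 ∨ t.1 = 16) ∧ (t.2.1 = 8 ∨ t.2.1 = 16) ∧ (t.2.2 = 8 ∨ t.2.2 = 16) := by
  decide

end H2QuadrisecantXXII

section H2BitangentTypesXXIII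

/-!
## XXIII (prover 3 gen 30, `H2-EXISTENCE-SIDE-23.md`): the two TYPES of bitangent pairs at EXACT points; Izadi–Pauly's tangent-line lemma

Arithmetic / bookkeeping shadows only (HONEST FRAMING as above). [IP01] = E. Izadi, C. Pauly, *Some properties of second order theta functions
on Prym varieties*, Math. Nachr. 230 (2001) 73–91 = arXiv:math/9904001, proof of Lemma 4.4: for `s̃, t̃ ∈ C̃` the translate `i(C̃) + [s̃] + [t̃]` of
the Abel–Prym curve passes through `i(s̃)` and `i(t̃)` with the tangent directions SWAPPED, and its two embedded tangent lines in `|2Ξ'₀|^*` meet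
(dimension count on `ω_{C̃} ⊗ x^{-2}`) — which is [XXII] THEOREM Q (c) + COR Q2 (nearest prior art, found by this seat). The numerical part of
[XXIII] (kit jobs on the recorded finds of [XVI] j107282) is NOT reflected here beyond the integer predictions it tests.
-/

/-- [IP01] Lemma 4.4 (proof), bookkeeping in any additive commutative group (the Abel–Prym classes `S = [s̃]`, `T = [t̃]`, a two-torsion shift `η`):
the translate by `x = S + T` of the carrier `{P + η}` passes through `a = S + η` at the parameter `P = −T` (`= [σt̃]`) and through `a' = T + η` at
`P = −S` — so TWO translates of the Abel–Prym curve pass through `a, a'`: the carrier itself and this one; and the difference bookkeeping behind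
'exactly these two' (`P − Q = S − T` is solved by `(P, Q) = (S, T)` and by `(P, Q) = (−T, −S)`, the second giving the translation `a − P − η = S + T`). -/
theorem ip_translate_through_both {G : Type*} [AddCommGroup G] (S T η : G) :
    ((-T) + η + (S + T) = S + η) ∧ ((-S) + η + (S + T) = T + η) ∧ ((-T) - (-S) = S - T) ∧ ((S + η) - (-T) - η = S + T) := by
  refine ⟨by abel, by abel, by abel, by abel⟩

/-- [IP01] Lemma 4.4 (proof), the direction swap: the second translate meets `a = S + η` at the parameter `−T`, whose point on the carrier is
`−T + η = −(T + η) = −a'` when `2η = 0`; so its tangent direction at `a` is the carrier's tangent direction at `∓a'` (ι-invariance) — COR Q2's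
'polar member of `S_a` in the direction of the carrier's tangent at `a'`'. Recorded: `η + η = 0 → −T + η = −(T + η)`. -/
theorem ip_direction_swap {G : Type*} [AddCommGroup G] (T η : G) (hη : η + η = 0) : -T + η = -(T + η) := by
  have hn : η = -η := eq_neg_iff_add_eq_zero.mpr hη
  calc -T + η = -T + (-η) := by rw [← hn]
    _ = -(T + η) := by abel

/-- [IP01] Lemma 4.4 (proof), the dimension count giving THEOREM Q (c) without Beauville–Debarre generality (only `C` non-hyperelliptic): on the
translate `Y ≅ C̃` (genus `9`) the bundle `𝒪_Y(2Θ) ≅ ω_{C̃} ⊗ L` has degree `16`, `L ≠ 𝒪` of degree `0`, so `h⁰ = 16 − 9 + 1 = 8` and (Beauville,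
Izadi–van Straten) `H⁰(A, 2Θ) → H⁰(Y, 2Θ|_Y)` is onto: `κ(Y)` spans a `ℙ⁷`. Sections vanishing doubly at the two points: `h⁰(ω_{C̃}(−2s̃ − 2t̃)) =
h⁰(𝒪(2s̃ + 2t̃)) − 4 − 1 + 9 ≥ 1 + 4 = 5` (Riemann–Roch; `𝒪(2s̃+2t̃)` is effective), i.e. the two tangent lines impose `≤ 8 − 5 = 3` conditions and span a
linear space of projective dimension `≤ 8 − 5 − 1 = 2`: two lines in a plane meet (`1 + 1 − 2 ≥ 0`). Each tangent line of `κ(Y) ⊂ Kum(A)` lies in the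
embedded tangent space of `Kum(A)`: `𝕋_{κ(a)} ∩ 𝕋_{κ(a')} ≠ ∅`. Recorded: the arithmetic. -/
theorem ip_coplanarity_count :
    ((16 : ℤ) - 9 + 1 = 8) ∧ (∀ h0 : ℤ, 1 ≤ h0 → 5 ≤ h0 - 4 - 1 + 9) ∧ (∀ h : ℤ, 5 ≤ h → 8 - h ≤ 3 ∧ 8 - h - 1 ≤ 2) ∧ ((0 : ℤ) ≤ 1 + 1 - 2) := by
  refine ⟨by norm_num, fun h0 h => by omega, fun h hh => by omega, by norm_num⟩

/-- THEOREM X (report §3: a non-ι-invariant translate of an Abel–Prym curve never lies in `S_a ∩ S_{a'}` for `a' ≠ ±a`), the group-theoretic core.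
If `Z + t ⊂ S_a ∩ S_{a'}` then `a ± t, a' ± t ∈ T_Z`, so `a + t, a' + t ∈ T_Z ∩ (T_Z + d)` with `d = 2t`; on a general presentation the two points
`p₁, p₂` of `T_Z ∩ (T_Z + d)` (`d ∈ W`, unique representation `d = [x₀] + [y₀]`) satisfy `p₁ + p₂ = d`; hence `{a + t, a' + t} = {p₁, p₂}` forces
`a + a' + 2t = 2t`, i.e. `a' = −a`. Recorded: in any additive commutative group, `d = t + t`, `p₁ + p₂ = d` and `{a + t, a' + t} = {p₁, p₂}` (either
matching) give `a + a' = 0`. -/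
theorem ap_translate_exclusion {G : Type*} [AddCommGroup G] (a a' t d p₁ p₂ : G)
    (hd : d = t + t) (hsum : p₁ + p₂ = d)
    (h : (a + t = p₁ ∧ a' + t = p₂) ∨ (a + t = p₂ ∧ a' + t = p₁)) : a + a' = 0 := by
  have key : (a + t) + (a' + t) = t + t := by
    rcases h with ⟨h1, h2⟩ | ⟨h1, h2⟩
    · rw [h1, h2, hsum, hd]
    · rw [h1, h2, add_comm, hsum, hd]
  have h3 : a + a' + (t + t) = 0 + (t + t) := by
    rw [zero_add]
    calc a + a' + (t + t) = (a + t) + (a' + t) := by abel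
      _ = t + t := key
  exact add_right_cancel h3

/-- PROPOSITION C2 (report §4: two carriers through `a, a'` give a LINE of common members) and its intersection bookkeeping. Two distinct carriers
`Z₁, Z₂ ∋ a, a'` give two common members `E₁ ≠ E₂` (distinct tangent lines through `κ(a) ∉ 𝕋_{κ(a')}`), so `dim 𝕋_{κ(a)} ∩ 𝕋_{κ(a')} ≥ 1`, and
`S_a ∩ S_{a'} ⊇ T_{Z₁} ∪ T_{Z₂}`. IF the shared curve is exactly the nodal union of the two genus-`9` class-`2γ` curves meeting transversally in
`n` points (arithmetic genus `9 + 9 + n − 1`) with no residual points, the excess count `16·4 − (2p_a − 2) = 24` forces `n = 4`; each `T_{Z_i}` imposes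
`5` conditions on `|2Θ|`, the union `5 + 5 − m` with `m = dim ⟨κ T_{Z₁}⟩ ∩ ⟨κ T_{Z₂}⟩`; `kdim = (5 + 5 − m) − 6 ≥ 2 ⟺ m ≤ 2` (`m = 2`: the two
`ℙ⁴`'s meet exactly in the line through the two Kummer points of the four nodes), while `m = 4` would give `6` conditions and `kdim = 0`. Recorded:
the arithmetic (the hypothesis 'exactly the nodal union' is NOT claimed in the report; §5 measures it). -/
theorem two_carrier_union_counts :
    (∀ n : ℤ, 16 * 4 - (2 * (9 + 9 + n - 1) - 2) = 32 - 2 * n) ∧ (∀ n : ℤ, 32 - 2 * n = 24 ↔ n = 4) ∧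
    ((5 : ℤ) + 5 - 2 = 8 ∧ (8 : ℤ) - 6 = 2 ∧ (5 : ℤ) + 5 - 4 = 6 ∧ (6 : ℤ) - 6 = 0) ∧ (∀ m : ℤ, 2 ≤ 5 + 5 - m - 6 ↔ m ≤ 2) := by
  refine ⟨fun n => by ring, fun n => by constructor <;> intro h <;> omega, by norm_num, fun m => by constructor <;> intro h <;> omega⟩

/-- THEOREM X / COROLLARY D (report §3: the class dichotomy for a shared curve with NO residual points), bookkeeping on the surface `S_a`
(`K_{S_a} = 2θ|_{S_a}`, `θ|_{S_a}² = 24`). If `S_a ∩ S_{a'} = C'` cleanly, `C'` irreducible of class `kγ` (θ-degree `4k`) and genus `g`: `24 =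
16k − (2g − 2)`, i.e. `g = 8k − 11`; the residual `D'` of `C'` in the theta section `Γ = S_a ∩ Θ_{a'}` has class `(6 − k)γ`; `k = 5` is impossible
(`D'` of class `γ`: Matsusaka–Ran), `k = 2` would need `g = 5 ≠ 9` (Welters), so `k ∈ {3, 4}`; invariants: `C'² = 2g − 2 − 8k = 8k − 24`, `D'² =
24 − 8k + C'² = 0`, `C'·D' = 4k − C'² = 24 − 4k`, `g(D') = 25 − 4k` (adjunction `2g − 2 = D'² + 2·4(6−k)`), and `p_a(Γ) = g(C') + g(D') + C'·D' − 1 =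
37` for every `k` (check: `2·37 − 2 = 24 + 48`). For `k = 4`: `D'` has class `2γ`, genus `9`, `D'² = 0` — an Abel–Prym curve (Welters), which THEOREM X
then forces to be a CARRIER; for `k = 3`: `C'` and `D'` both of class `3γ`, genus `13`, self-intersection `0`, meeting in `12` points. Recorded: the
arithmetic. -/
theorem shared_curve_class_bookkeeping :
    (∀ k g : ℤ, 24 = 16 * k - (2 * g - 2) ↔ g = 8 * k - 11) ∧
    (∀ k : ℤ, (2 * (8 * k - 11) - 2 - 8 * k = 8 * k - 24) ∧ (24 - 2 * (4 * k) + (8 * k - 24) = 0) ∧ (4 * k - (8 * k - 24) = 24 - 4 * k) ∧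
       (0 + 2 * (4 * (6 - k)) = 2 * (25 - 4 * k) - 2) ∧ ((8 * k - 11) + (25 - 4 * k) + (24 - 4 * k) - 1 = 37)) ∧
    ((2 : ℤ) * 37 - 2 = 24 + 48) ∧
    (∀ k : ℕ, (k = 2 ∨ k = 3 ∨ k = 4 ∨ k = 5) → 6 - k ≠ 1 → 8 * k - 11 ≠ 5 → (k = 3 ∨ k = 4)) ∧
    ((8 : ℤ) * 4 - 24 = 8 ∧ (25 : ℤ) - 4 * 4 = 9 ∧ (24 : ℤ) - 4 * 4 = 8 ∧ (8 : ℤ) * 3 - 24 = 0 ∧ (25 : ℤ) - 4 * 3 = 13 ∧ (24 : ℤ) - 4 * 3 = 12) := by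
  refine ⟨fun k g => by constructor <;> intro h <;> omega, fun k => ⟨by ring, by ring, by ring, by ring, by ring⟩, by norm_num, ?_, by norm_num⟩
  rintro k (rfl | rfl | rfl | rfl) h1 h2 <;> omega

/-- §5 (report, the rank method): the number of conditions a point set imposes on `|nΘ|`, `n = 2, 3, 4` (`h⁰ = 16, 81, 256`), via the level-`n`
theta bases. Predictions tested: a smooth curve of θ-degree `4k` and genus `g` with nonspecial, surjective restrictions imposes `4kn + 1 − g`
conditions — `(k, g) = (2, 9)`: `16, 24` for `n = 3, 4`; `(3, 13)`: `24, 36`; `(4, 21)`: `28, 44`; `(5, 29)`: `32, 52`; the CONTROLS: the surface `S_a`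
imposes `16 − 5 = 11`, `81 − (16 + 16 − 1) = 50` (Koszul: `h⁰(𝓘_{S_a}(3Θ)) = h⁰(Θ_{−a}) ⊗ … = 16 + 16 − 1`), `256 − (81 + 81 − 16) = 110` conditions;
a general translate `Z + t` of an Abel–Prym curve imposes `16 + 1 − 9 = 8` conditions on `|2Θ|` ([IP01]: `h⁰(ω ⊗ x^{-2}) = 2g_C − 2 = 8`, restriction
onto), an ι-invariant one `5` (`= g_C`). Recorded: the arithmetic. -/
theorem rank_predictions :
    (∀ k g n : ℤ, 4 * k * n + 1 - g = 4 * k * n - (g - 1)) ∧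
    ((12 : ℤ) * 2 + 1 - 9 = 16 ∧ (16 : ℤ) * 2 + 1 - 9 = 24 ∧ (12 : ℤ) * 3 + 1 - 13 = 24 ∧ (16 : ℤ) * 3 + 1 - 13 = 36 ∧
      (12 : ℤ) * 4 + 1 - 21 = 28 ∧ (16 : ℤ) * 4 + 1 - 21 = 44 ∧ (12 : ℤ) * 5 + 1 - 29 = 32 ∧ (16 : ℤ) * 5 + 1 - 29 = 52) ∧
    ((16 : ℤ) - 5 = 11 ∧ (81 : ℤ) - (16 + 16 - 1) = 50 ∧ (256 : ℤ) - (81 + 81 - 16) = 110) ∧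
    ((16 : ℤ) + 1 - 9 = 8 ∧ (2 : ℤ) * 5 - 2 = 8 ∧ (5 : ℤ) = 5) := by
  refine ⟨fun k g n => by ring, by norm_num, by norm_num, by norm_num⟩

/-- §5 (report): why rank-`8` points are unexpected and why truncated numerics cannot 'see' an excess locus without exact Newton polishing. For the
`16 × 10` matrix `[Λ_a | Λ_{a'}]` over the `8`-dimensional `A × A`: rank `≤ 9` has expected codimension `(16 − 9)(10 − 9) = 7` (expected dimension
`8 − 7 = 1`; the actual `M` is `4`-dimensional — excess), rank `≤ 8` has expected codimension `(16 − 8)(10 − 8) = 16 > 8` (expected dimension `−8`;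
[XXIII] finds EXACT rank-`8` points — the second type M-II), rank `≤ 7`: `27`. Recorded: the arithmetic. -/
theorem rank_drop_codimensions :
    ((16 : ℤ) - 9) * (10 - 9) = 7 ∧ (8 : ℤ) - 7 = 1 ∧ ((16 : ℤ) - 8) * (10 - 8) = 16 ∧ (8 : ℤ) - 16 = -8 ∧ ((16 : ℤ) - 7) * (10 - 7) = 27 := by
  norm_num

end H2BitangentTypesXXIII

section H2BitangentTypesXXIIIb

/-!
## XXIII §4 (prover 3 gen 30): the NODAL-CARRIER structure of the second type (CONJECTURE M2) — bookkeeping shadows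

`Z_n` an ι-invariant nodal Abel–Prym curve with node at `0` (ramified presentation, [FNS21]); `Z* = T_{Z_n}` its theta-dual; a pair `(a, a')` with
`u = a − a'`, `w = a + a'` on `Z_n`. Only additive bookkeeping and integer counts are recorded; the geometry (LEMMA TC, CONJECTURE M2) is pen-and-paper /
numerical in the report.
-/

/-- LEMMA TC (c) (report 4.2), the translate incidences as identities in an additive commutative group: `Z* + a' ⊂ Θ_x ⟺ Z* ⊂ Θ_{x − a'}`, and for
`x ∈ {a', a, −a}` the shifts `x − a'` are `0, u, −w`; for `Z* − a'` and `x ∈ {−a', a, −a}`: `0, w, −u`; for `Z* + a` and `x ∈ {a, a', −a'}`: `0, −u, −w`; for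
`Z* − a` and `x ∈ {−a, a', −a'}`: `0, w, u` — all in `{0, ±u, ±w} ⊂ V(Z*)` when `u, w ∈ Z_n = −Z_n ∋ 0`. Recorded: the twelve differences. -/
theorem tc_translate_incidences {G : Type*} [AddCommGroup G] (a a' : G) :
    (a' - a' = 0 ∧ a - a' = (a - a') ∧ -a - a' = -(a + a')) ∧
    (-a' - (-a') = 0 ∧ a - (-a') = a + a' ∧ -a - (-a') = -(a - a')) ∧
    (a - a = 0 ∧ a' - a = -(a - a') ∧ -a' - a = -(a + a')) ∧
    (-a - (-a) = 0 ∧ a' - (-a) = a + a' ∧ -a' - (-a) = a - a') := by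
  refine ⟨⟨by abel, by abel, by abel⟩, ⟨by abel, by abel, by abel⟩, ⟨by abel, by abel, by abel⟩, ⟨by abel, by abel, by abel⟩⟩

/-- CONJECTURE M2 (ii) (report 4.4), the four theta translates containing the shared curve `C' = R + a'`: `V(R) ⊇ {0, u, −w, u − w}` (the nodal BD1) is
symmetric under `x ↦ (u − w) − x` (so `R`, hence `C'`, is ι-invariant about the centre `(u − w)/2 = −a'`), and `a' + {0, u, −w, u − w} = {a', a, −a, −a'}`
because `u − w = −2a'`. Recorded: the arithmetic, with `u = a − a'`, `w = a + a'`. -/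
theorem typeII_VC_bookkeeping {G : Type*} [AddCommGroup G] (a a' : G) :
    let u := a - a'
    let w := a + a'
    (a' + 0 = a' ∧ a' + u = a ∧ a' + (-w) = -a ∧ a' + (u - w) = -a') ∧ (u - w = -(a' + a')) ∧
    ((u - w) - 0 = u - w ∧ (u - w) - u = -w ∧ (u - w) - (-w) = u ∧ (u - w) - (u - w) = 0) ∧ (u + w = a + a ∧ w - u = a' + a') := by
  refine ⟨⟨by abel, by abel, by abel, by abel⟩, by abel, ⟨by abel, by abel, by abel, by abel⟩, by abel, by abel⟩

/-- CONJECTURE M2 (iii) (report 4.4), the Izadi–Pauly-type count on the nodal translate `Y = Z_n + a'` (through `a` at a smooth point and through `a'` at its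
node): `h⁰(𝒪_Y(2Θ)) = 16 + 1 − 9 = 8` (arithmetic genus `9`); vanishing doubly at `a` costs `2`, vanishing on the first-order neighbourhood of the node `3`
(`dim 𝒪/𝔪² = 3` at a node of an embedded curve… recorded as the count used), expected remainder `8 − 5 = 3`, with the conjectured '+1' it is `4`; then the
tangent line at `κ(a)` and the plane of the two branch tangents at `κ(a')` span a linear space of projective dimension `8 − 4 − 1 = 3`, in which a line and a
plane meet (`1 + 2 − 3 ≥ 0`); two such translates `Z_n ± a'` give two members, hence `kdim ≥ 2`; the dimension of M-II: `1` (ramified presentations) `+ 2`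
(two points of `Z_n`) `= 3`, one less than `M_Z`'s `2 + 2 = 4`. Recorded: the arithmetic (the '+1' is NOT proved). -/
theorem nodal_ip_count :
    ((16 : ℤ) + 1 - 9 = 8) ∧ ((8 : ℤ) - (2 + 3) = 3) ∧ ((3 : ℤ) + 1 = 4) ∧ ((8 : ℤ) - 4 - 1 = 3) ∧ ((0 : ℤ) ≤ 1 + 2 - 3) ∧
    ((1 : ℤ) + 2 = 3 ∧ (2 : ℤ) + 2 = 4 ∧ (4 : ℤ) - 3 = 1) ∧ ((10 : ℤ) - 8 = 2) := by
  norm_num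

/-- §2.4 (report), the Izadi–Pauly mechanism exhausted on ONE étale presentation: the coplanarity bonus for a translate `Z + y` through `a = [u] + y`,
`a' = [v] + y` needs `2y ∼ ±(2u + 2v − D₄)` for one of the nine lifts `D₄` of `2ū + 2v̄`; parity (number of flipped points must be even for `y ∈ P`): the lifts
with `0, 2, 2, 4` flips are `2u+2v` (`2y = 0`: TYPE I on `Z_y`), `u+σu+v+σv` (`2y = −[u] − [v]`: then `a + a' = [u] + [v] + 2y = 0`, the excess `a' = −a`),
`2σu + 2v` / `2u + 2σv` (a point in `A[2]`), `2σu + 2σv` (`y = −[u] − [v] + ε`: TYPE I again). Recorded: the flip-parity table and the one identity. -/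
theorem ip_mechanism_cases {G : Type*} [AddCommGroup G] (U V y : G) (h : y + y = -(U + V)) :
    (U + y) + (V + y) = 0 ∧ ((0 : ℕ) % 2 = 0 ∧ 1 % 2 = 1 ∧ 2 % 2 = 0 ∧ 3 % 2 = 1 ∧ 4 % 2 = 0) := by
  refine ⟨?_, by decide⟩
  calc (U + y) + (V + y) = (U + V) + (y + y) := by abel
    _ = (U + V) + -(U + V) := by rw [h]
    _ = 0 := by abel

end H2BitangentTypesXXIIIb

end Summit.HodgeConjecture.HodgeConjecture.WeilTypeLadder
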